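import Mathlib
import Summits.PneNP.PneNP.Theorems.CnfIdealGenLengthRankDefectRepresentationsBandCompletion
import Summits.PneNP.PneNP.Theorems.CnfIdealGenLengthRankDefectRepresentationsBandAveraging
import Summits.PneNP.PneNP.Theorems.CnfIdealGenLengthRankDefectRepresentationsDoubleMaxCutFour
import Summits.PneNP.PneNP.Theorems.CnfIdealGenLengthRankDefectRepresentationsCloseFour

/-!
# Crux `RankDefectRepresentations` (stmt-PneNP-18923), line `rank-dehn-ladder`: the registered lead stub `stub_adjacentSplitting` CLOSED (lead g16, RESHAPE 16)

ADJACENT SPLITTING with the absolute constant `C₀ = 8` (`e = 0`) and half-budgets `0 + 0`: from the constant-4 decomposition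
(`…DoubleMaxCutFour.doubleMaxCut_four` instantiated with the landed X1 `…BandCompletion.stub_bandCompletion` and X2 `…BandAveraging.stub_bandAveraging`) via `…CloseFour.adjacentSplitting_of_four` (`G := L ∘ 1[last bits agree]`).
HONEST FRAMING: closes a registered TOOL stub of the negative lane; the item (RDR) stays open; P ≠ NP is not moved; F-N2 is a FRONTIER formal rung.
-/

set_option linter.dupNamespace false -- `Summit.PneNP.PneNP.…`: summit = sub-problem name (D-0017)

namespace Summit.PneNP.PneNP.Theorems.CnfIdealGenLengthRankDefectRepresentationsAdjacentSplittingFour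

/-- **Registered lead stub `stub_adjacentSplitting` of `Lines/rank_dehn_ladder.lean`** (verbatim signature), with `C₀ = 8`, `e = 0`. -/
theorem stub_adjacentSplitting :
    ∃ C₀ e : ℕ, ∀ (K : Type) [Field K] (n n' : ℕ),
      (∀ (ι ι' : Type) [Fintype ι] [Fintype ι'] [DecidableEq ι] [DecidableEq ι']
          (row : ι → Fin n ⊕ Fin (n' + 1) → Bool) (col : ι' → Fin n ⊕ Fin (n' + 1) → Bool) (D : Matrix ι ι' K) (c : ℕ),
          (∀ B B', Summit.PneNP.PneNP.Theorems.CnfIdealGenLengthRankDefectRepresentationsTwoFamilyCutDomination.doubleCut row col B B' D ≤ c) →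
          ∃ G : Matrix ι ι' K,
            (∀ x y, row x (Sum.inr (Fin.last n')) ≠ col y (Sum.inr (Fin.last n')) → G x y = 0) ∧
            G.rank ≤ (C₀ * (n + n' + 2) ^ e) * c ∧
            ∃ c₀ c₁ : ℕ, c₀ + c₁ ≤ c ∧
              (∀ B B', Summit.PneNP.PneNP.Theorems.CnfIdealGenLengthRankDefectRepresentationsTwoFamilyCutDomination.doubleCut
                  (Summit.PneNP.PneNP.Theorems.CnfIdealGenLengthRankDefectRepresentationsMergeReduction.rowHalf row false)
                  (Summit.PneNP.PneNP.Theorems.CnfIdealGenLengthRankDefectRepresentationsMergeReduction.colHalf col false) B B'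
                  ((D - G).submatrix Subtype.val Subtype.val) ≤ c₀) ∧
              (∀ B B', Summit.PneNP.PneNP.Theorems.CnfIdealGenLengthRankDefectRepresentationsTwoFamilyCutDomination.doubleCut
                  (Summit.PneNP.PneNP.Theorems.CnfIdealGenLengthRankDefectRepresentationsMergeReduction.rowHalf row true)
                  (Summit.PneNP.PneNP.Theorems.CnfIdealGenLengthRankDefectRepresentationsMergeReduction.colHalf col true) B B'
                  ((D - G).submatrix Subtype.val Subtype.val) ≤ c₁)) :=
  Summit.PneNP.PneNP.Theorems.CnfIdealGenLengthRankDefectRepresentationsCloseFour.adjacentSplitting_of_four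
    (fun K _ n n' =>
      Summit.PneNP.PneNP.Theorems.CnfIdealGenLengthRankDefectRepresentationsDoubleMaxCutFour.doubleMaxCut_four (K := K)
        Summit.PneNP.PneNP.Theorems.CnfIdealGenLengthRankDefectRepresentationsBandCompletion.stub_bandCompletion
        Summit.PneNP.PneNP.Theorems.CnfIdealGenLengthRankDefectRepresentationsBandAveraging.stub_bandAveraging n n')

end Summit.PneNP.PneNP.Theorems.CnfIdealGenLengthRankDefectRepresentationsAdjacentSplittingFour
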